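import Summits.QuantumFields.BalabanUV.Beta.FP.StepRecursionFeedNestedCompFed
import Summits.QuantumFields.BalabanUV.Beta.FP.WSlotSplit
import Summits.QuantumFields.BalabanUV.Beta.FP.TowerNParityRowsEven

/-!
# `BalabanUV.Beta.FP.StepRecursionFeedNestedCompDoor` — road «FP» for binder row D1: **THE DOOR FED AS N-DATA LANDS IN THE END AS THE DEFECT
# `D j μ ν z = −½·tadpole (AN j) (𝒲Δ j μ 0 ν z)` — AS A THEOREM** (SPEC-64 §1 (O3)∕(O4), §10 (ii-A″); the kernel law stated for the FED second-order
# family `WN j + 𝒲Δ j` (N-side placement), `WSlotSplit.hessKer_add_W`, then `StepRecursionFeedNestedCompUpTo` ∕ `…CompFed` BY NAME; the N-leg's spread and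
# the record family's localisation DISCHARGED BY NAME — road `TowerNParityRowsEven.spr_AN` (⟸ an2 `NVertexSectors.decays_AN`) ∕ `exists_biLoc_WN` (⟸ an2 `NVertexParities`))

WHY.  `…CompUpTo` (p645294) and `…CompFed` (p648931) take the door as an ABSTRACT defect family `D j` added to the kernel law.  A v10-class wrapper feeding the door
family `𝒲Δ` as N-DATA (SPEC-64 (ii-A), an2 A-2 pins α–δ) hands over instead the law FOR THE FED FAMILY — `hessKer (AN j) (VN j) (WN j + 𝒲Δ j) μ ν z = hessKer F_j + hessKer G_j`
(what `TowerKernelLawNamedC` concludes when its N-slot is fed `WN + 𝒲Δ`).  By `hessKer_add_W` (the one-loop kernel is additive in its W-slot: `Spr` leg, `Loc` members)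
that IS the law of `…CompUpTo` with the EXPLICIT defect `D j μ ν z := −½·tadpole (AN j) (𝒲Δ j μ 0 ν z)` — the door family's TADPOLE against the record's one-shot
propagator, i.e. EXACTLY the scalar that the by-value gate G2 (Engine C K2L-DTAD, n = 0) measures entrywise and G2-M2 folds into decimated moments.  This file types
that sentence: the END at the record pair with the door DISPLAYED AS DATA (`𝒲Δ`, its `Loc` letter `hWΔ`) and the law FOR THE FED FAMILY, concluding `D1Tel` ∕ `D1Sum`
from an4's remainder binders ON THE TADPOLE DEFECT — per storey (`…CompUpTo` shape) or, with the fed transport and the covariance row, at the base only (`…CompFed` shape).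

WHAT.  Blocking `Lc` (`[NeZero Lc]`, `Odd Lc`), dimension four, ROOT M‴'s `Js := JsB12CombShSym hLc N (symTablesAn1S2 3 Lc cΛ) cΛ cB` UNCHANGED, `Jc := JcComp hLc N cΛ cB R P`.
* §1 [folklore] `law_upTo_of_fedW` — generic: `Spr A`, `Loc (W μ 0 ν z)`, `Loc (𝒲Δ μ 0 ν z)`, `hessKer A V (W + 𝒲Δ) μ ν z = rhs` ⟹ `hessKer A V W μ ν z = rhs + (−½·tadpole A (𝒲Δ μ 0 ν z))`;
  `hessKer_fedW_eq_sub` — the fed kernel entrywise: `hessKer A V (W + 𝒲Δ) c e t = hessKer A V W c e t − (−½·tadpole A (𝒲Δ c 0 e t))`; `loc_WN` — `Loc` of every member of the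
  record family (road `TowerNParityRowsEven.exists_biLoc_WN` BY NAME; the N-leg's `Spr` is `TowerNParityRowsEven.spr_AN`, used BY NAME, not restated).
* §2 [folklore] **PER-STOREY SHAPE**: `d1Tel_JcComp_nested_of_hessKer_laws_fedW_wStep` (+ `_ctr`) and `d1Sum_JcComp_ctr_nested_of_hessKer_laws_fedW_wStep` — #31's rows with
  `hlaw` replaced by the law FOR THE FED FAMILY `hlawΔ`, the door family `𝒲Δ` and its letter `hWΔ : ∀ j μ ν z, Loc (𝒲Δ j μ 0 ν z)` DISPLAYED, `hF₁ htr hG hT0 hT1` VERBATIM, and an4's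
  `hD0 hD1 hDA hD2` (resp. `hDF`) ON `fun j μ ν z ↦ −½·tadpole (AN R j) (𝒲Δ j μ 0 ν z)` ⟹ `D1Tel` (resp. `D1Sum`).
* §3 [folklore] **BASE-ONLY SHAPE**: `d1Tel_JcComp_ctr_nested_of_hessKer_laws_fedW_fed_wStep` ∕ `d1Sum_…` — the same with the FED transport stated for the FED kernel
  (`htrΔ : hessKer F_{j+1} μ ν z = Lc⁸·dressedEntry (wStep Lc (j+1)) (hessKer (AN j) (VN j) (WN j + 𝒲Δ j)) (Lc•z) μ ν` — v9's `htr` with the fed family inside), the covariance row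
  `hDΔtr` of the tadpole defect, `hDA ∀ j`, and the base binders ⟹ `D1Tel` (resp. `D1Sum`) — `…CompFed` after `hessKer_fedW_eq_sub` under the dressing (`funext`).
[folklore] composition BY NAME + `hessKer_add_W`; no `def`, no `def … : Prop`, nothing cited, 0 sorry.  Every displayed row is a HYPOTHESIS; nothing of the dictionary ∕ Bałaban's
asserted, valued or discharged; NO tadpole claimed to vanish, to be covariant or to be invisible (G2 ∕ G2-M2 ∕ G3 unmeasured or pending, zero weight); `hDΔ` NOT displayed and NOT
claimed; targets `D1Tel`∕`D1Sum` UNCHANGED ((ii-D) NOT typed); NOT a law file (the law for the fed family is a displayed ROW, to be handed by `TowerKernelLawNamedC` fed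
`WN + 𝒲Δ` in a v10-class wrapper — NOT typed here, policy).  No existing file touched.

HONEST DEPENDENCY (page 1, mandatory): continuum YM on T⁴ ⇐ BetaPertH ∧ nine spine estimates (0/9 proved); BetaPertH ⇐ (D1) ∧ (D4) ∧ CAP+tail;
G-an2-4 gates asym, D1 and NE2/3/4.  HONEST FRAMING (cell contract, verbatim): «discharging `BetaPertH` makes Bałaban's UV stability UNCONDITIONAL —
a real constructive-QFT result; it is NOT the continuum limit and NOT the Clay problem.»  ABSOLUTE RULE (cell charter, verbatim): «No internally-minted
statement may enter as a cited fact. Every hypothesis is either kernel-proved in this package or a verbatim quotation of a PUBLISHED theorem with page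
reference. The manuscript(s) under audit are NOT citable for their own disputed steps — they are the thing under adjudication; programme-internal
(2001/route/tribunal) claims are never citable.»  0 estimates; 0∕4 row-D1 binders (hW, hR, D1Tel, D1Rep); ROOT M‴ p325680 untouched; NOT (C1), NOT (L2′)
beyond `hN`'s name, NOT (T-ID), NOT SDF, NOT D1, NEVER «G-an2-4 closed», NOT BetaPertH, NOT continuum, NOT Clay.  Road «FP» OWNER, b2b-balaban-beta-d1-p3
gen 51, 2026-08-28.  No existing file touched.
-/

noncomputable section

namespace Summit.QuantumFields.BalabanUV.Beta.FP.StepRecursionFeedNestedCompDoor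

open Finset
open Literature.MathematicalPhysics.QuantumFieldTheory
open Literature.MathematicalPhysics.QuantumFieldTheory.Balaban1983to89
open Literature.MathematicalPhysics.QuantumFieldTheory.Balaban1983to89.Beta
open Literature.MathematicalPhysics.QuantumFieldTheory.Balaban1983to89.B12Beta (secondMoment)
open DecimatedMomentSummable (AbsMoment₂)
open DressedMomentNormalisation (EKer dressedEntry m2Tensor)
open ExpKernelCalculus (Site MKer tadpole hessKer)
open OneStepResolventKernel (Fib JetData)
open OneStepKernelFamily (TshotOf TbalOf D1Tel)
open HessianTelescopingKKT (wStep)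
open StepDriftWitness (D1Sum)
open Summit.QuantumFields.BalabanUV.Beta.TameKernelCalculus (Spr Loc)
open Summit.QuantumFields.BalabanUV.Beta.FP.WSlotSplit (hessKer_add_W)
open Summit.QuantumFields.BalabanUV.Beta.SymSecondOrderTablesAn1 (symTablesAn1S2)
open Summit.QuantumFields.BalabanUV.Beta.CombChartJointEnd (JsB12CombShSym)
open Summit.QuantumFields.BalabanUV.Beta.CompositeOneShotJetData (Roots Pins JcComp AN VN WN)
open Summit.QuantumFields.BalabanUV.Beta.FP.TowerNParityRowsEven (spr_AN exists_biLoc_WN)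
open Summit.QuantumFields.BalabanUV.Beta.FP.StepRecursionFeedNestedCompUpTo
  (d1Tel_JcComp_nested_of_hessKer_laws_upTo_wStep d1Sum_JcComp_nested_of_hessKer_laws_upTo_wStep)
open Summit.QuantumFields.BalabanUV.Beta.FP.StepRecursionFeedNestedCompFed
  (d1Tel_JcComp_ctr_nested_of_hessKer_laws_fed_wStep d1Sum_JcComp_ctr_nested_of_hessKer_laws_fed_wStep)

/-! ## §1 The law for the fed family IS the law with the tadpole defect; the N-side letters by name -/

section Generic

variable {D : ℕ} {F : Type*} [Fintype F]

/-- [folklore] **THE LAW FOR THE FED FAMILY IS THE LAW WITH THE TADPOLE DEFECT**: for a spread leg `A`, localised members `W μ 0 ν z` and `𝒲Δ μ 0 ν z`, if the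
one-loop kernel of the FED family `W + 𝒲Δ` equals `rhs` at `(μ, ν, z)`, then the one-loop kernel of `W` equals `rhs + (−½·tadpole A (𝒲Δ μ 0 ν z))` there
(`WSlotSplit.hessKer_add_W`). -/
theorem law_upTo_of_fedW {A : MKer D F} (hA : Spr A) (V : Fin D → Site D → MKer D F) {W 𝒲Δ : Fin D → Site D → Fin D → Site D → MKer D F}
    (μ ν : Fin D) (z : Site D) (hW : Loc (W μ 0 ν z)) (hΔ : Loc (𝒲Δ μ 0 ν z)) {rhs : ℝ} (hfed : hessKer A V (W + 𝒲Δ) μ ν z = rhs) :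
    hessKer A V W μ ν z = rhs + (-(1 / 2 : ℝ) * tadpole A (𝒲Δ μ 0 ν z)) := by
  rw [hessKer_add_W hA V μ ν z hW hΔ] at hfed
  linarith

/-- [folklore] **THE FED KERNEL ENTRYWISE**: `hessKer A V (W + 𝒲Δ) c e t = hessKer A V W c e t − (−½·tadpole A (𝒲Δ c 0 e t))`. -/
theorem hessKer_fedW_eq_sub {A : MKer D F} (hA : Spr A) (V : Fin D → Site D → MKer D F) {W 𝒲Δ : Fin D → Site D → Fin D → Site D → MKer D F}
    (c e : Fin D) (t : Site D) (hW : Loc (W c 0 e t)) (hΔ : Loc (𝒲Δ c 0 e t)) :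
    hessKer A V (W + 𝒲Δ) c e t = hessKer A V W c e t - (-(1 / 2 : ℝ) * tadpole A (𝒲Δ c 0 e t)) := by
  rw [hessKer_add_W hA V c e t hW hΔ]
  ring

end Generic

section Letters

variable {Lc : ℕ} [NeZero Lc] (R : Roots Lc) (P : Pins)

/-- [folklore] every member of the record's second-order family is LOCALISED (`TowerNParityRowsEven.exists_biLoc_WN` ⟸ an2 `NVertexParities.vertexFamilies_VN_WN`, BY NAME);
the N-leg's spread `Spr (AN R j)` is `TowerNParityRowsEven.spr_AN` (⟸ an2 `NVertexSectors.decays_AN`), used below BY NAME and not restated. -/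
theorem loc_WN (j : ℕ) (μ : Fin (3 + 1)) (y : Site (3 + 1)) (ν : Fin (3 + 1)) (y' : Site (3 + 1)) : Loc (WN R P j μ y ν y') := by
  obtain ⟨Cw, δw, -, hδw, hW⟩ := exists_biLoc_WN R P j μ y ν y'
  exact ⟨_, _, Cw, δw, hδw, hW⟩

end Letters

/-! ## §2 Per-storey shape: the END at the record pair with the door displayed as data and the law for the fed family -/

section PerStorey

variable {Lc : ℕ} [NeZero Lc] {FF FG : Type*} [Fintype FF] [Fintype FG]

/-- [folklore] **ROOT M‴'s `htel` AT THE RECORD PAIR, NESTED CURRENCY, THE DOOR FED AS N-DATA** (SPEC-64 §10 (ii-A″), `…CompUpTo` shape).  DISPLAYED: the door family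
`𝒲Δ j` with its localisation letter `hWΔ`; the kernel law FOR THE FED FAMILY `hlawΔ : hessKer (AN R j) (VN R P j) (WN R P j + 𝒲Δ j) μ ν z = hessKer F_j + hessKer G_j`
(`j ≥ 1`); #31's `hF₁ htr hG` (T0)(T1) VERBATIM; an4's four remainder binders ON THE TADPOLE DEFECT `D j μ ν z := −½·tadpole (AN R j) (𝒲Δ j μ 0 ν z)`, `j ≥ 1`
⟹ `D1Tel Lc Js (JcComp hLc N cΛ cB R P)`.  The N-leg's `Spr` and the record family's `Loc` are an2's theorems (inside). -/
theorem d1Tel_JcComp_nested_of_hessKer_laws_fedW_wStep (hLc : Odd Lc) (N : ℕ) (cΛ cB : ℝ) (R : Roots Lc) (P : Pins)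
    (AF : ℕ → MKer 4 FF) (𝒱F : ℕ → Fin 4 → (Fin 4 → ℤ) → MKer 4 FF) (𝒲F : ℕ → Fin 4 → (Fin 4 → ℤ) → Fin 4 → (Fin 4 → ℤ) → MKer 4 FF)
    (AG : ℕ → MKer 4 FG) (𝒱G : ℕ → Fin 4 → (Fin 4 → ℤ) → MKer 4 FG) (𝒲G : ℕ → Fin 4 → (Fin 4 → ℤ) → Fin 4 → (Fin 4 → ℤ) → MKer 4 FG)
    -- THE DOOR FAMILY, DISPLAYED AS DATA, with its localisation letter
    (𝒲Δ : ℕ → Fin (3 + 1) → Site (3 + 1) → Fin (3 + 1) → Site (3 + 1) → MKer (3 + 1) (Fib 3))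
    (hWΔ : ∀ (j : ℕ) (μ : Fin (3 + 1)) (ν : Fin (3 + 1)) (z : Site (3 + 1)), Loc (𝒲Δ j μ 0 ν z))
    -- THE KERNEL LAW FOR THE FED FAMILY (N-side placement)
    (hlawΔ : ∀ j : ℕ, 1 ≤ j → ∀ (μ ν : Fin 4) (z : Fin 4 → ℤ),
      hessKer (AN R j) (VN R P j) (WN R P j + 𝒲Δ j) μ ν z
        = hessKer (AF j) (𝒱F j) (𝒲F j) μ ν z + hessKer (AG j) (𝒱G j) (𝒲G j) μ ν z)
    (hF₁ : ∀ (μ ν : Fin 4) (z : Fin 4 → ℤ),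
      hessKer (AF 1) (𝒱F 1) (𝒲F 1) μ ν z
        = (Lc : ℝ) ^ 8 * dressedEntry (wStep Lc 1) (TshotOf Lc (JcComp hLc N cΛ cB R P) 1) ((Lc : ℤ) • z) μ ν)
    (htr : ∀ j : ℕ, 1 ≤ j → ∀ (μ ν : Fin 4) (z : Fin 4 → ℤ),
      hessKer (AF (j + 1)) (𝒱F (j + 1)) (𝒲F (j + 1)) μ ν z
        = (Lc : ℝ) ^ 8 * dressedEntry (wStep Lc (j + 1)) (hessKer (AN R j) (VN R P j) (WN R P j)) ((Lc : ℤ) • z) μ ν)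
    (hG : ∀ j : ℕ, 1 ≤ j → ∀ (μ ν : Fin 4) (z : Fin 4 → ℤ),
      hessKer (AG j) (𝒱G j) (𝒲G j) μ ν z = TbalOf Lc (JsB12CombShSym hLc N (symTablesAn1S2 3 Lc cΛ) cΛ cB) j μ ν z)
    (hT0 : ∀ j (c e : Fin 4), HasSum (TbalOf Lc (JsB12CombShSym hLc N (symTablesAn1S2 3 Lc cΛ) cΛ cB) j c e) 0)
    (hT1 : ∀ j (c e ρ : Fin 4), HasSum (fun t : Fin 4 → ℤ => t ρ • TbalOf Lc (JsB12CombShSym hLc N (symTablesAn1S2 3 Lc cΛ) cΛ cB) j c e t) 0)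
    -- an4's REMAINDER BINDERS ON THE TADPOLE DEFECT
    (hD0 : ∀ j, 1 ≤ j → ∀ c e : Fin 4, HasSum (fun z : Fin 4 → ℤ => -(1 / 2 : ℝ) * tadpole (AN R j) (𝒲Δ j c 0 e z)) 0)
    (hD1 : ∀ j, 1 ≤ j → ∀ c e ρ : Fin 4, HasSum (fun z : Fin 4 → ℤ => z ρ • (-(1 / 2 : ℝ) * tadpole (AN R j) (𝒲Δ j c 0 e z))) 0)
    (hDA : ∀ j, 1 ≤ j → ∀ c e : Fin 4, AbsMoment₂ (fun z : Fin 4 → ℤ => -(1 / 2 : ℝ) * tadpole (AN R j) (𝒲Δ j c 0 e z)))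
    (hD2 : ∀ j, 1 ≤ j → m2Tensor (fun c e z => -(1 / 2 : ℝ) * tadpole (AN R j) (𝒲Δ j c 0 e z)) = 0) :
    D1Tel Lc (JsB12CombShSym hLc N (symTablesAn1S2 3 Lc cΛ) cΛ cB) (JcComp hLc N cΛ cB R P) :=
  d1Tel_JcComp_nested_of_hessKer_laws_upTo_wStep hLc N cΛ cB R P AF 𝒱F 𝒲F AG 𝒱G 𝒲G
    (fun j c e z => -(1 / 2 : ℝ) * tadpole (AN R j) (𝒲Δ j c 0 e z))
    (fun j hj μ ν z => law_upTo_of_fedW (spr_AN R j) (VN R P j) μ ν z (loc_WN R P j μ 0 ν z) (hWΔ j μ ν z) (hlawΔ j hj μ ν z))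
    hF₁ htr hG hT0 hT1 hD0 hD1 hDA hD2

/-- [folklore] **THE (β1) TOWER's INSTANCE** — the same at `R := Roots.ctr Lc`. -/
theorem d1Tel_JcComp_ctr_nested_of_hessKer_laws_fedW_wStep (hLc : Odd Lc) (N : ℕ) (cΛ cB : ℝ) (P : Pins)
    (AF : ℕ → MKer 4 FF) (𝒱F : ℕ → Fin 4 → (Fin 4 → ℤ) → MKer 4 FF) (𝒲F : ℕ → Fin 4 → (Fin 4 → ℤ) → Fin 4 → (Fin 4 → ℤ) → MKer 4 FF)
    (AG : ℕ → MKer 4 FG) (𝒱G : ℕ → Fin 4 → (Fin 4 → ℤ) → MKer 4 FG) (𝒲G : ℕ → Fin 4 → (Fin 4 → ℤ) → Fin 4 → (Fin 4 → ℤ) → MKer 4 FG)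
    (𝒲Δ : ℕ → Fin (3 + 1) → Site (3 + 1) → Fin (3 + 1) → Site (3 + 1) → MKer (3 + 1) (Fib 3))
    (hWΔ : ∀ (j : ℕ) (μ : Fin (3 + 1)) (ν : Fin (3 + 1)) (z : Site (3 + 1)), Loc (𝒲Δ j μ 0 ν z))
    (hlawΔ : ∀ j : ℕ, 1 ≤ j → ∀ (μ ν : Fin 4) (z : Fin 4 → ℤ),
      hessKer (AN (Roots.ctr Lc) j) (VN (Roots.ctr Lc) P j) (WN (Roots.ctr Lc) P j + 𝒲Δ j) μ ν z
        = hessKer (AF j) (𝒱F j) (𝒲F j) μ ν z + hessKer (AG j) (𝒱G j) (𝒲G j) μ ν z)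
    (hF₁ : ∀ (μ ν : Fin 4) (z : Fin 4 → ℤ),
      hessKer (AF 1) (𝒱F 1) (𝒲F 1) μ ν z
        = (Lc : ℝ) ^ 8 * dressedEntry (wStep Lc 1) (TshotOf Lc (JcComp hLc N cΛ cB (Roots.ctr Lc) P) 1) ((Lc : ℤ) • z) μ ν)
    (htr : ∀ j : ℕ, 1 ≤ j → ∀ (μ ν : Fin 4) (z : Fin 4 → ℤ),
      hessKer (AF (j + 1)) (𝒱F (j + 1)) (𝒲F (j + 1)) μ ν z
        = (Lc : ℝ) ^ 8 * dressedEntry (wStep Lc (j + 1))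
            (hessKer (AN (Roots.ctr Lc) j) (VN (Roots.ctr Lc) P j) (WN (Roots.ctr Lc) P j)) ((Lc : ℤ) • z) μ ν)
    (hG : ∀ j : ℕ, 1 ≤ j → ∀ (μ ν : Fin 4) (z : Fin 4 → ℤ),
      hessKer (AG j) (𝒱G j) (𝒲G j) μ ν z = TbalOf Lc (JsB12CombShSym hLc N (symTablesAn1S2 3 Lc cΛ) cΛ cB) j μ ν z)
    (hT0 : ∀ j (c e : Fin 4), HasSum (TbalOf Lc (JsB12CombShSym hLc N (symTablesAn1S2 3 Lc cΛ) cΛ cB) j c e) 0)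
    (hT1 : ∀ j (c e ρ : Fin 4), HasSum (fun t : Fin 4 → ℤ => t ρ • TbalOf Lc (JsB12CombShSym hLc N (symTablesAn1S2 3 Lc cΛ) cΛ cB) j c e t) 0)
    (hD0 : ∀ j, 1 ≤ j → ∀ c e : Fin 4, HasSum (fun z : Fin 4 → ℤ => -(1 / 2 : ℝ) * tadpole (AN (Roots.ctr Lc) j) (𝒲Δ j c 0 e z)) 0)
    (hD1 : ∀ j, 1 ≤ j → ∀ c e ρ : Fin 4,
      HasSum (fun z : Fin 4 → ℤ => z ρ • (-(1 / 2 : ℝ) * tadpole (AN (Roots.ctr Lc) j) (𝒲Δ j c 0 e z))) 0)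
    (hDA : ∀ j, 1 ≤ j → ∀ c e : Fin 4, AbsMoment₂ (fun z : Fin 4 → ℤ => -(1 / 2 : ℝ) * tadpole (AN (Roots.ctr Lc) j) (𝒲Δ j c 0 e z)))
    (hD2 : ∀ j, 1 ≤ j → m2Tensor (fun c e z => -(1 / 2 : ℝ) * tadpole (AN (Roots.ctr Lc) j) (𝒲Δ j c 0 e z)) = 0) :
    D1Tel Lc (JsB12CombShSym hLc N (symTablesAn1S2 3 Lc cΛ) cΛ cB) (JcComp hLc N cΛ cB (Roots.ctr Lc) P) :=
  d1Tel_JcComp_nested_of_hessKer_laws_fedW_wStep hLc N cΛ cB (Roots.ctr Lc) P AF 𝒱F 𝒲F AG 𝒱G 𝒲G 𝒲Δ hWΔ hlawΔ hF₁ htr hG hT0 hT1 hD0 hD1 hDA hD2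

/-- [folklore] **THE READ-OUT-LEVEL TWIN** (channel `(μ, ν)`, (β1) instance): the same rows with `hDF : secondMoment (tadpole defect of storey j) μ ν = 0` in place of `hD2`
⟹ the lead's `D1Sum Lc Js (JcComp … (Roots.ctr Lc) P) μ ν`. -/
theorem d1Sum_JcComp_ctr_nested_of_hessKer_laws_fedW_wStep (hLc : Odd Lc) (N : ℕ) (cΛ cB : ℝ) (P : Pins)
    (AF : ℕ → MKer 4 FF) (𝒱F : ℕ → Fin 4 → (Fin 4 → ℤ) → MKer 4 FF) (𝒲F : ℕ → Fin 4 → (Fin 4 → ℤ) → Fin 4 → (Fin 4 → ℤ) → MKer 4 FF)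
    (AG : ℕ → MKer 4 FG) (𝒱G : ℕ → Fin 4 → (Fin 4 → ℤ) → MKer 4 FG) (𝒲G : ℕ → Fin 4 → (Fin 4 → ℤ) → Fin 4 → (Fin 4 → ℤ) → MKer 4 FG)
    (𝒲Δ : ℕ → Fin (3 + 1) → Site (3 + 1) → Fin (3 + 1) → Site (3 + 1) → MKer (3 + 1) (Fib 3))
    (hWΔ : ∀ (j : ℕ) (μ : Fin (3 + 1)) (ν : Fin (3 + 1)) (z : Site (3 + 1)), Loc (𝒲Δ j μ 0 ν z)) (μ ν : Fin 4)
    (hlawΔ : ∀ j : ℕ, 1 ≤ j → ∀ (μ ν : Fin 4) (z : Fin 4 → ℤ),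
      hessKer (AN (Roots.ctr Lc) j) (VN (Roots.ctr Lc) P j) (WN (Roots.ctr Lc) P j + 𝒲Δ j) μ ν z
        = hessKer (AF j) (𝒱F j) (𝒲F j) μ ν z + hessKer (AG j) (𝒱G j) (𝒲G j) μ ν z)
    (hF₁ : ∀ (μ ν : Fin 4) (z : Fin 4 → ℤ),
      hessKer (AF 1) (𝒱F 1) (𝒲F 1) μ ν z
        = (Lc : ℝ) ^ 8 * dressedEntry (wStep Lc 1) (TshotOf Lc (JcComp hLc N cΛ cB (Roots.ctr Lc) P) 1) ((Lc : ℤ) • z) μ ν)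
    (htr : ∀ j : ℕ, 1 ≤ j → ∀ (μ ν : Fin 4) (z : Fin 4 → ℤ),
      hessKer (AF (j + 1)) (𝒱F (j + 1)) (𝒲F (j + 1)) μ ν z
        = (Lc : ℝ) ^ 8 * dressedEntry (wStep Lc (j + 1))
            (hessKer (AN (Roots.ctr Lc) j) (VN (Roots.ctr Lc) P j) (WN (Roots.ctr Lc) P j)) ((Lc : ℤ) • z) μ ν)
    (hG : ∀ j : ℕ, 1 ≤ j → ∀ (μ ν : Fin 4) (z : Fin 4 → ℤ),
      hessKer (AG j) (𝒱G j) (𝒲G j) μ ν z = TbalOf Lc (JsB12CombShSym hLc N (symTablesAn1S2 3 Lc cΛ) cΛ cB) j μ ν z)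
    (hT0 : ∀ j (c e : Fin 4), HasSum (TbalOf Lc (JsB12CombShSym hLc N (symTablesAn1S2 3 Lc cΛ) cΛ cB) j c e) 0)
    (hT1 : ∀ j (c e ρ : Fin 4), HasSum (fun t : Fin 4 → ℤ => t ρ • TbalOf Lc (JsB12CombShSym hLc N (symTablesAn1S2 3 Lc cΛ) cΛ cB) j c e t) 0)
    (hD0 : ∀ j, 1 ≤ j → ∀ c e : Fin 4, HasSum (fun z : Fin 4 → ℤ => -(1 / 2 : ℝ) * tadpole (AN (Roots.ctr Lc) j) (𝒲Δ j c 0 e z)) 0)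
    (hD1 : ∀ j, 1 ≤ j → ∀ c e ρ : Fin 4,
      HasSum (fun z : Fin 4 → ℤ => z ρ • (-(1 / 2 : ℝ) * tadpole (AN (Roots.ctr Lc) j) (𝒲Δ j c 0 e z))) 0)
    (hDA : ∀ j, 1 ≤ j → ∀ c e : Fin 4, AbsMoment₂ (fun z : Fin 4 → ℤ => -(1 / 2 : ℝ) * tadpole (AN (Roots.ctr Lc) j) (𝒲Δ j c 0 e z)))
    (hDF : ∀ j, 1 ≤ j → secondMoment (fun c e z => -(1 / 2 : ℝ) * tadpole (AN (Roots.ctr Lc) j) (𝒲Δ j c 0 e z)) μ ν = 0) :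
    D1Sum Lc (JsB12CombShSym hLc N (symTablesAn1S2 3 Lc cΛ) cΛ cB) (JcComp hLc N cΛ cB (Roots.ctr Lc) P) μ ν :=
  d1Sum_JcComp_nested_of_hessKer_laws_upTo_wStep hLc N cΛ cB (Roots.ctr Lc) P AF 𝒱F 𝒲F AG 𝒱G 𝒲G
    (fun j c e z => -(1 / 2 : ℝ) * tadpole (AN (Roots.ctr Lc) j) (𝒲Δ j c 0 e z)) μ ν
    (fun j hj μ' ν' z => law_upTo_of_fedW (spr_AN (Roots.ctr Lc) j) (VN (Roots.ctr Lc) P j) μ' ν' z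
      (loc_WN (Roots.ctr Lc) P j μ' 0 ν' z) (hWΔ j μ' ν' z) (hlawΔ j hj μ' ν' z))
    hF₁ htr hG hT0 hT1 hD0 hD1 hDA hDF

end PerStorey

/-! ## §3 Base-only shape: the fed transport stated for the fed kernel, the covariance row of the tadpole defect -/

section BaseOnly

variable {Lc : ℕ} [NeZero Lc] {FF FG : Type*} [Fintype FF] [Fintype FG]

/-- [folklore] **ROOT M‴'s `htel` AT THE RECORD PAIR, THE DOOR FED AS N-DATA CONSISTENTLY, ITS TADPOLE DEFECT `htr`-COVARIANT** (`…CompFed` shape, (β1) instance).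
DISPLAYED: `𝒲Δ`, `hWΔ`; the law for the fed family `hlawΔ`; `hF₁` door-free; the FED TRANSPORT FOR THE FED KERNEL `htrΔ` (v9's `htr` with `WN j + 𝒲Δ j` inside the
dressing); `hG` (T0)(T1); `hDA ∀ j` and the covariance row `hDΔtr` of the tadpole defect `D j μ ν z := −½·tadpole (AN j) (𝒲Δ j μ 0 ν z)`; an4's binders AT THE BASE
`hD0₁ hD1₁ hD2₁` ⟹ `D1Tel`.  (`hessKer_fedW_eq_sub` turns the fed kernel inside the dressing into `hessKer N^rec − D j`, then `…CompFed` §3.) -/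
theorem d1Tel_JcComp_ctr_nested_of_hessKer_laws_fedW_fed_wStep (hLc : Odd Lc) (N : ℕ) (cΛ cB : ℝ) (P : Pins)
    (AF : ℕ → MKer 4 FF) (𝒱F : ℕ → Fin 4 → (Fin 4 → ℤ) → MKer 4 FF) (𝒲F : ℕ → Fin 4 → (Fin 4 → ℤ) → Fin 4 → (Fin 4 → ℤ) → MKer 4 FF)
    (AG : ℕ → MKer 4 FG) (𝒱G : ℕ → Fin 4 → (Fin 4 → ℤ) → MKer 4 FG) (𝒲G : ℕ → Fin 4 → (Fin 4 → ℤ) → Fin 4 → (Fin 4 → ℤ) → MKer 4 FG)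
    (𝒲Δ : ℕ → Fin (3 + 1) → Site (3 + 1) → Fin (3 + 1) → Site (3 + 1) → MKer (3 + 1) (Fib 3))
    (hWΔ : ∀ (j : ℕ) (μ : Fin (3 + 1)) (ν : Fin (3 + 1)) (z : Site (3 + 1)), Loc (𝒲Δ j μ 0 ν z))
    (hlawΔ : ∀ j : ℕ, 1 ≤ j → ∀ (μ ν : Fin 4) (z : Fin 4 → ℤ),
      hessKer (AN (Roots.ctr Lc) j) (VN (Roots.ctr Lc) P j) (WN (Roots.ctr Lc) P j + 𝒲Δ j) μ ν z
        = hessKer (AF j) (𝒱F j) (𝒲F j) μ ν z + hessKer (AG j) (𝒱G j) (𝒲G j) μ ν z)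
    (hF₁ : ∀ (μ ν : Fin 4) (z : Fin 4 → ℤ),
      hessKer (AF 1) (𝒱F 1) (𝒲F 1) μ ν z
        = (Lc : ℝ) ^ 8 * dressedEntry (wStep Lc 1) (TshotOf Lc (JcComp hLc N cΛ cB (Roots.ctr Lc) P) 1) ((Lc : ℤ) • z) μ ν)
    (htrΔ : ∀ j : ℕ, 1 ≤ j → ∀ (μ ν : Fin 4) (z : Fin 4 → ℤ),
      hessKer (AF (j + 1)) (𝒱F (j + 1)) (𝒲F (j + 1)) μ ν z
        = (Lc : ℝ) ^ 8 * dressedEntry (wStep Lc (j + 1))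
            (hessKer (AN (Roots.ctr Lc) j) (VN (Roots.ctr Lc) P j) (WN (Roots.ctr Lc) P j + 𝒲Δ j)) ((Lc : ℤ) • z) μ ν)
    (hG : ∀ j : ℕ, 1 ≤ j → ∀ (μ ν : Fin 4) (z : Fin 4 → ℤ),
      hessKer (AG j) (𝒱G j) (𝒲G j) μ ν z = TbalOf Lc (JsB12CombShSym hLc N (symTablesAn1S2 3 Lc cΛ) cΛ cB) j μ ν z)
    (hT0 : ∀ j (c e : Fin 4), HasSum (TbalOf Lc (JsB12CombShSym hLc N (symTablesAn1S2 3 Lc cΛ) cΛ cB) j c e) 0)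
    (hT1 : ∀ j (c e ρ : Fin 4), HasSum (fun t : Fin 4 → ℤ => t ρ • TbalOf Lc (JsB12CombShSym hLc N (symTablesAn1S2 3 Lc cΛ) cΛ cB) j c e t) 0)
    (hDA : ∀ j, 1 ≤ j → ∀ c e : Fin 4, AbsMoment₂ (fun z : Fin 4 → ℤ => -(1 / 2 : ℝ) * tadpole (AN (Roots.ctr Lc) j) (𝒲Δ j c 0 e z)))
    (hDΔtr : ∀ j : ℕ, 1 ≤ j → ∀ (μ ν : Fin 4) (z : Fin 4 → ℤ),
      -(1 / 2 : ℝ) * tadpole (AN (Roots.ctr Lc) (j + 1)) (𝒲Δ (j + 1) μ 0 ν z)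
        = (Lc : ℝ) ^ 8 * dressedEntry (wStep Lc (j + 1))
            (fun c e t => -(1 / 2 : ℝ) * tadpole (AN (Roots.ctr Lc) j) (𝒲Δ j c 0 e t)) ((Lc : ℤ) • z) μ ν)
    (hD0₁ : ∀ c e : Fin 4, HasSum (fun z : Fin 4 → ℤ => -(1 / 2 : ℝ) * tadpole (AN (Roots.ctr Lc) 1) (𝒲Δ 1 c 0 e z)) 0)
    (hD1₁ : ∀ c e ρ : Fin 4, HasSum (fun z : Fin 4 → ℤ => z ρ • (-(1 / 2 : ℝ) * tadpole (AN (Roots.ctr Lc) 1) (𝒲Δ 1 c 0 e z))) 0)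
    (hD2₁ : m2Tensor (fun c e z => -(1 / 2 : ℝ) * tadpole (AN (Roots.ctr Lc) 1) (𝒲Δ 1 c 0 e z)) = 0) :
    D1Tel Lc (JsB12CombShSym hLc N (symTablesAn1S2 3 Lc cΛ) cΛ cB) (JcComp hLc N cΛ cB (Roots.ctr Lc) P) := by
  have hfed : ∀ j : ℕ, hessKer (AN (Roots.ctr Lc) j) (VN (Roots.ctr Lc) P j) (WN (Roots.ctr Lc) P j + 𝒲Δ j)
      = fun c e t => hessKer (AN (Roots.ctr Lc) j) (VN (Roots.ctr Lc) P j) (WN (Roots.ctr Lc) P j) c e t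
          - (-(1 / 2 : ℝ) * tadpole (AN (Roots.ctr Lc) j) (𝒲Δ j c 0 e t)) :=
    fun j => funext fun c => funext fun e => funext fun t =>
      hessKer_fedW_eq_sub (spr_AN (Roots.ctr Lc) j) (VN (Roots.ctr Lc) P j) c e t (loc_WN (Roots.ctr Lc) P j c 0 e t) (hWΔ j c e t)
  refine d1Tel_JcComp_ctr_nested_of_hessKer_laws_fed_wStep hLc N cΛ cB P AF 𝒱F 𝒲F AG 𝒱G 𝒲G
    (fun j c e z => -(1 / 2 : ℝ) * tadpole (AN (Roots.ctr Lc) j) (𝒲Δ j c 0 e z))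
    (fun j hj μ ν z => law_upTo_of_fedW (spr_AN (Roots.ctr Lc) j) (VN (Roots.ctr Lc) P j) μ ν z
      (loc_WN (Roots.ctr Lc) P j μ 0 ν z) (hWΔ j μ ν z) (hlawΔ j hj μ ν z))
    hF₁ (fun j hj μ ν z => ?_) hG hT0 hT1 hDA hDΔtr hD0₁ hD1₁ hD2₁
  rw [htrΔ j hj μ ν z, hfed j]

/-- [folklore] **THE READ-OUT-LEVEL TWIN OF THE BASE-ONLY SHAPE** (channel `(μ, ν)`): the same rows with the base binder `hDF₁ : secondMoment (tadpole defect of storey 1) μ ν = 0`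
in place of `hD2₁` ⟹ the lead's `D1Sum Lc Js (JcComp … (Roots.ctr Lc) P) μ ν`. -/
theorem d1Sum_JcComp_ctr_nested_of_hessKer_laws_fedW_fed_wStep (hLc : Odd Lc) (N : ℕ) (cΛ cB : ℝ) (P : Pins)
    (AF : ℕ → MKer 4 FF) (𝒱F : ℕ → Fin 4 → (Fin 4 → ℤ) → MKer 4 FF) (𝒲F : ℕ → Fin 4 → (Fin 4 → ℤ) → Fin 4 → (Fin 4 → ℤ) → MKer 4 FF)
    (AG : ℕ → MKer 4 FG) (𝒱G : ℕ → Fin 4 → (Fin 4 → ℤ) → MKer 4 FG) (𝒲G : ℕ → Fin 4 → (Fin 4 → ℤ) → Fin 4 → (Fin 4 → ℤ) → MKer 4 FG)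
    (𝒲Δ : ℕ → Fin (3 + 1) → Site (3 + 1) → Fin (3 + 1) → Site (3 + 1) → MKer (3 + 1) (Fib 3))
    (hWΔ : ∀ (j : ℕ) (μ : Fin (3 + 1)) (ν : Fin (3 + 1)) (z : Site (3 + 1)), Loc (𝒲Δ j μ 0 ν z)) (μ ν : Fin 4)
    (hlawΔ : ∀ j : ℕ, 1 ≤ j → ∀ (μ ν : Fin 4) (z : Fin 4 → ℤ),
      hessKer (AN (Roots.ctr Lc) j) (VN (Roots.ctr Lc) P j) (WN (Roots.ctr Lc) P j + 𝒲Δ j) μ ν z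
        = hessKer (AF j) (𝒱F j) (𝒲F j) μ ν z + hessKer (AG j) (𝒱G j) (𝒲G j) μ ν z)
    (hF₁ : ∀ (μ ν : Fin 4) (z : Fin 4 → ℤ),
      hessKer (AF 1) (𝒱F 1) (𝒲F 1) μ ν z
        = (Lc : ℝ) ^ 8 * dressedEntry (wStep Lc 1) (TshotOf Lc (JcComp hLc N cΛ cB (Roots.ctr Lc) P) 1) ((Lc : ℤ) • z) μ ν)
    (htrΔ : ∀ j : ℕ, 1 ≤ j → ∀ (μ ν : Fin 4) (z : Fin 4 → ℤ),
      hessKer (AF (j + 1)) (𝒱F (j + 1)) (𝒲F (j + 1)) μ ν z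
        = (Lc : ℝ) ^ 8 * dressedEntry (wStep Lc (j + 1))
            (hessKer (AN (Roots.ctr Lc) j) (VN (Roots.ctr Lc) P j) (WN (Roots.ctr Lc) P j + 𝒲Δ j)) ((Lc : ℤ) • z) μ ν)
    (hG : ∀ j : ℕ, 1 ≤ j → ∀ (μ ν : Fin 4) (z : Fin 4 → ℤ),
      hessKer (AG j) (𝒱G j) (𝒲G j) μ ν z = TbalOf Lc (JsB12CombShSym hLc N (symTablesAn1S2 3 Lc cΛ) cΛ cB) j μ ν z)
    (hT0 : ∀ j (c e : Fin 4), HasSum (TbalOf Lc (JsB12CombShSym hLc N (symTablesAn1S2 3 Lc cΛ) cΛ cB) j c e) 0)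
    (hT1 : ∀ j (c e ρ : Fin 4), HasSum (fun t : Fin 4 → ℤ => t ρ • TbalOf Lc (JsB12CombShSym hLc N (symTablesAn1S2 3 Lc cΛ) cΛ cB) j c e t) 0)
    (hDA : ∀ j, 1 ≤ j → ∀ c e : Fin 4, AbsMoment₂ (fun z : Fin 4 → ℤ => -(1 / 2 : ℝ) * tadpole (AN (Roots.ctr Lc) j) (𝒲Δ j c 0 e z)))
    (hDΔtr : ∀ j : ℕ, 1 ≤ j → ∀ (μ ν : Fin 4) (z : Fin 4 → ℤ),
      -(1 / 2 : ℝ) * tadpole (AN (Roots.ctr Lc) (j + 1)) (𝒲Δ (j + 1) μ 0 ν z)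
        = (Lc : ℝ) ^ 8 * dressedEntry (wStep Lc (j + 1))
            (fun c e t => -(1 / 2 : ℝ) * tadpole (AN (Roots.ctr Lc) j) (𝒲Δ j c 0 e t)) ((Lc : ℤ) • z) μ ν)
    (hD0₁ : ∀ c e : Fin 4, HasSum (fun z : Fin 4 → ℤ => -(1 / 2 : ℝ) * tadpole (AN (Roots.ctr Lc) 1) (𝒲Δ 1 c 0 e z)) 0)
    (hD1₁ : ∀ c e ρ : Fin 4, HasSum (fun z : Fin 4 → ℤ => z ρ • (-(1 / 2 : ℝ) * tadpole (AN (Roots.ctr Lc) 1) (𝒲Δ 1 c 0 e z))) 0)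
    (hDF₁ : secondMoment (fun c e z => -(1 / 2 : ℝ) * tadpole (AN (Roots.ctr Lc) 1) (𝒲Δ 1 c 0 e z)) μ ν = 0) :
    D1Sum Lc (JsB12CombShSym hLc N (symTablesAn1S2 3 Lc cΛ) cΛ cB) (JcComp hLc N cΛ cB (Roots.ctr Lc) P) μ ν := by
  have hfed : ∀ j : ℕ, hessKer (AN (Roots.ctr Lc) j) (VN (Roots.ctr Lc) P j) (WN (Roots.ctr Lc) P j + 𝒲Δ j)
      = fun c e t => hessKer (AN (Roots.ctr Lc) j) (VN (Roots.ctr Lc) P j) (WN (Roots.ctr Lc) P j) c e t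
          - (-(1 / 2 : ℝ) * tadpole (AN (Roots.ctr Lc) j) (𝒲Δ j c 0 e t)) :=
    fun j => funext fun c => funext fun e => funext fun t =>
      hessKer_fedW_eq_sub (spr_AN (Roots.ctr Lc) j) (VN (Roots.ctr Lc) P j) c e t (loc_WN (Roots.ctr Lc) P j c 0 e t) (hWΔ j c e t)
  refine d1Sum_JcComp_ctr_nested_of_hessKer_laws_fed_wStep hLc N cΛ cB P AF 𝒱F 𝒲F AG 𝒱G 𝒲G
    (fun j c e z => -(1 / 2 : ℝ) * tadpole (AN (Roots.ctr Lc) j) (𝒲Δ j c 0 e z)) μ ν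
    (fun j hj μ' ν' z => law_upTo_of_fedW (spr_AN (Roots.ctr Lc) j) (VN (Roots.ctr Lc) P j) μ' ν' z
      (loc_WN (Roots.ctr Lc) P j μ' 0 ν' z) (hWΔ j μ' ν' z) (hlawΔ j hj μ' ν' z))
    hF₁ (fun j hj μ' ν' z => ?_) hG hT0 hT1 hDA hDΔtr hD0₁ hD1₁ hDF₁
  rw [htrΔ j hj μ' ν' z, hfed j]

end BaseOnly

end Summit.QuantumFields.BalabanUV.Beta.FP.StepRecursionFeedNestedCompDoor

end
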